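import Summits.ABC.IUTFork.Joshi.TestRealMeasureDichotomy
import Summits.ABC.IUTFork.Joshi.TestVolumeMatchSupplement
import HarnessLib

/-!
# Branch E, X-07″/X-07‴ — the real-measure dichotomy in its DIRECTION-FREE (mismatch) form
# (block-E adversary seat abc-iut-E-cx, gen 2; sequel to abc-iut-E-t44's `Joshi/TestRealMeasureDichotomy.lean` p433142 and
# abc-iut-E-cx-2's `Joshi/TestVolumeMatchSupplement.lean` p434968)

AUTHORED BY abc-iut-E-cx (refuter seat refuter-abc-iut-E-cx-g2-0); proxy-filed VERBATIM by a prover hand (cell PROXY RULE). Record file of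
the abc-iut cell, branch E «type Joshi's construction, test vs S» (rung LADDER-ABC:A2.E). **No side is taken** on [IUTchIII] Cor. 3.12, on
Joshi's claims (arXiv:2401.13508v4, unrefereed preprint) or on Mochizuki's report on them; typed ≠ proved ≠ endorsed. PROOF-ONLY over
p433142 (abc-iut-E-t44), p434968 / p432720 (abc-iut-E-cx-2), p431585 (abc-iut-E-t43), p428758 / p429682 (abc-iut-E-cx gen 0): 0 new `def`,
no `Prop` fact, no instance, no `sorry`. S := `Cor312Vol.PilotKummerIndRelated S P ρ qK`.

## Why this file
E-LOCATION §L1 books the EXHAUSTIVENESS of the trichotomy by p433142's `not_pilotKummerIndRelated_and_statement_of_realMeasure`: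
«at ONE packet with HONEST pilot volumes — every Frobenius-shift Θ-datum region `ρ(Ψ^{(m)})` of strictly SMALLER log-volume than the
q-datum region `ρ qK` (Mochizuki-normalised exponents `j² > 1`) — `¬(S ∧ Statement)`, whatever (Ind1)/(Ind2) are». That hypothesis is
DIRECTION-BOUND: in Joshi's normalisation ([J-III] (9.9.4): exponent `j²/ℓ*²` against the q-datum's `1`, q pinned at the LAST label;
E-LOCATION §L2, abc-iut-E-t4's object-honest setting p429514) the Θ-datum regions sit ABOVE the q-region at every label `j < ℓ*`
(abc-iut-E-cx-2's `honestJoshiSetting_logvol_ne`) and match it EXACTLY at the top label (`honestJoshiSetting_logvol_eq_top`), so the cited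
theorem is silent there. abc-iut-E-cx-2 (p434968 `not_statement_of_pilotKummerIndRelated_of_ne_of_character`) already has the
direction-free form GIVEN volume characters of the generators at the packet. THIS FILE composes the two: the real-measure reading supplies the
characters (p433142 `volumeCharacter_of_realMeasure` — the modulus, [AbsTopIII] Prop. 5.7 (i)(b)) and the packet-monotonicity
(`IntegralStructure.normalizedLogVolume_mono`), so that

* **`not_statement_of_pilotKummerIndRelated_of_realMeasure_of_ne`** — at a real-measure reading of ONE packet `(j, v_ℚ)`, `j ∈ 𝔽_l^⋇`, with
  the (Ind1)/(Ind2) generators realised there by ANY bicontinuous additive automorphisms of the container: admissible Θ-Kummer datum regions one of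
  which lies in `Θ3`, Thm 3.11 (ii)(b) for column `n`, (hρ), and log-volumes of ALL Frobenius-shift Θ-datum regions DIFFERENT from the q-datum
  region's (EITHER direction) ⟹ S forces `¬Statement ∧ ¬BridgeHyps`;
* **`not_pilotKummerIndRelated_and_statement_of_realMeasure_of_ne`** — packaged as `¬(S ∧ Statement)`;
* `…_of_thetaPinned` — under the typed Θ-pin the `Θ3` side condition is automatic (p434968 `exists_subset_thetaRegion3_of_thetaPinned`);
* `…_of_lt` / `…_of_gt` — the two directions as corollaries: `_of_lt` is p433142's honest form WITHOUT its hypotheses `hq` (q-region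
  admissible), `hΘm` (an admissible column Θ-region) and the GLOBAL `LogvolMono P` (replaced by the `Θ3` side condition, automatic under the
  pin); `_of_gt` is the Joshi-normalised direction (Θ above q), new in tree currency at the real-measure level.

LOCATED SENTENCE (tree currency, no side taken): «In OUR typed frame — Θ-hull := hull of the FULL ⟨Ind1 ∪ Ind2⟩-orbit, log-volumes = real
normalised Haar log-volumes — at ANY packet of a label in `𝔽_l^⋇` where NO Frobenius-shift Θ-datum region has the q-datum region's log-volume
(Θ below q as in the object-honest Mochizuki-normalised models, OR Θ above q as at the labels `j < ℓ*` of Joshi's normalisation), no realisation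
whatsoever of (Ind1)/(Ind2) by bicontinuous additive automorphisms of the log-shell containers yields S together with the printed inequality as
typed.» The only packets exempt are those of exact VOLUME MATCH (abc-iut-E-cx-2's X-07‴, p432720). Which (Ind2) [IUTchIII] intends and whether the
hull is taken over the orbit remain the attach points of E-LOCATION §L1 — recorded, not decided. Non-vacuity of the real-measure reading: the
Dupuy–Hilado real instantiation (abc-iut-E-t43 p430041 / p435161); of the mismatch in the `>` direction: abc-iut-E-t4's p429514 (toy carriers,
p434968 §3) — a real-carrier packet with Θ above q is not exhibited here and is not needed by the theorems.
[claim: Mochizuki2012, status: disputed] [claim: Joshi2024ATS3, status: disputed] [cite: MochizukiAbsTopIII2015, Prop. 5.7 (i)(b) p. 138]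
-/

noncomputable section

open Set MeasureTheory
open scoped ENNReal

namespace Summit.ABC.IUTFork.Joshi

open Thm311 Cor312 Cor312Vol Literature.IUT.LogVolume

variable {T : ThetaIndex} {S : LatticeSituation T} (P : Cor312.Setting S.toSituation)
  (ρ : (∀ v : T.V, v ∈ T.Vbad → Set (S.L.StarPacket v)) → ∀ (j : T.Label) (vQ : T.VQ), Set (S.L.Packet j vQ))
  (qK : ∀ v : T.V, v ∈ T.Vbad → Set (S.L.StarPacket v))
  {W : T.Label → T.VQ → Type*} [∀ j vQ, AddCommGroup (W j vQ)]
  [∀ j vQ, TopologicalSpace (W j vQ)] [∀ j vQ, IsTopologicalAddGroup (W j vQ)]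
  [∀ j vQ, MeasurableSpace (W j vQ)] [∀ j vQ, BorelSpace (W j vQ)]
  (Λ : ∀ j vQ, IntegralStructure (W j vQ)) (d : T.Label → T.VQ → ℕ)
  (e : ∀ (j : T.Label) (vQ : T.VQ), S.L.Packet j vQ → W j vQ)

/-- Packet-local monotonicity of the typed log-volume at a real-measure reading of ONE packet
(`IntegralStructure.normalizedLogVolume_mono`); the one-packet form of p433142's `logvolMono_of_realMeasure`. [folklore] -/
theorem logvolMonoAt_of_realMeasure {j : T.Label} {vQ : T.VQ}
    (hlogvol : ∀ A : Set (S.L.Packet j vQ), (S.D P.n).logvol j vQ A = (Λ j vQ).normalizedLogVolume (d j vQ) (e j vQ '' A))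
    (hAdm : ∀ A : Set (S.L.Packet j vQ),
      (S.D P.n).Adm j vQ A ↔ 0 < (Λ j vQ).haar (e j vQ '' A) ∧ (Λ j vQ).haar (e j vQ '' A) < ∞) :
    ∀ A B : Set (S.L.Packet j vQ), (S.D P.n).Adm j vQ A → (S.D P.n).Adm j vQ B → A ⊆ B →
      (S.D P.n).logvol j vQ A ≤ (S.D P.n).logvol j vQ B := by
  intro A B hA hB hAB
  rw [hlogvol, hlogvol]
  exact (Λ j vQ).normalizedLogVolume_mono (d j vQ) ((hAdm A).1 hA).1 ((hAdm B).1 hB).2 (image_mono hAB)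

/-- **S ∧ volume MISMATCH (either direction) at one packet of a label of `𝔽_l^⋇` ⟹ ¬Statement ∧ ¬BridgeHyps — for EVERY realisation of
(Ind1)/(Ind2) by bicontinuous additive automorphisms of the container.** Hypotheses at the packet `(j = i+1, v_ℚ)` only: the real-measure
reading (`logvol = μ^log_Λ(e(−))/d`, admissible = `0 < μ_Λ(e(−)) < ∞`), each (Ind1)/(Ind2) generator realised on the container by some
`ψ : W ≃ₜ+ W`, every Frobenius-shift Θ-Kummer datum region admissible, one of them inside `Θ3`, and ALL of log-volume `≠` the q-datum
region's; plus Thm 3.11 (ii)(b) for column `n` and the equivariance (hρ). The characters are the moduli (p433142 `volumeCharacter_of_realMeasure`);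
the rest is abc-iut-E-cx-2's `not_statement_of_pilotKummerIndRelated_of_ne_of_character` (p434968). [claim: Mochizuki2012, status: disputed] -/
theorem not_statement_of_pilotKummerIndRelated_of_realMeasure_of_ne {i : Fin T.lstar} {vQ : T.VQ}
    (hlogvol : ∀ A : Set (S.L.Packet (Setting.labelSucc i) vQ),
      (S.D P.n).logvol (Setting.labelSucc i) vQ A =
        (Λ (Setting.labelSucc i) vQ).normalizedLogVolume (d (Setting.labelSucc i) vQ) (e (Setting.labelSucc i) vQ '' A))
    (hAdm : ∀ A : Set (S.L.Packet (Setting.labelSucc i) vQ),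
      (S.D P.n).Adm (Setting.labelSucc i) vQ A ↔
        0 < (Λ (Setting.labelSucc i) vQ).haar (e (Setting.labelSucc i) vQ '' A) ∧
          (Λ (Setting.labelSucc i) vQ).haar (e (Setting.labelSucc i) vQ '' A) < ∞)
    (hInd : ∀ Φ ∈ S.L.Ind1Family ∪ S.L.Ind2Family,
      ∃ ψ : W (Setting.labelSucc i) vQ ≃ₜ+ W (Setting.labelSucc i) vQ,
        ∀ x, e (Setting.labelSucc i) vQ (Φ (Setting.labelSucc i) vQ x) = ψ (e (Setting.labelSucc i) vQ x))
    (hΘ : ∀ m : ℤ, (S.D P.n).Adm (Setting.labelSucc i) vQ (ρ ((S.col P.n).frobΨ m) (Setting.labelSucc i) vQ))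
    (hΘ3 : ∃ m : ℤ, ρ ((S.col P.n).frobΨ m) (Setting.labelSucc i) vQ ⊆ P.thetaRegion3 (Setting.labelSucc i) vQ)
    (hne : ∀ m : ℤ, (S.D P.n).logvol (Setting.labelSucc i) vQ (ρ ((S.col P.n).frobΨ m) (Setting.labelSucc i) vQ) ≠
      (S.D P.n).logvol (Setting.labelSucc i) vQ (ρ qK (Setting.labelSucc i) vQ))
    (hKumB : (S.col P.n).KummerB (S.D P.n))
    (hρ : ∀ Φ ∈ Subgroup.closure (S.L.Ind1Family ∪ S.L.Ind2Family),
      ∀ (Ψ : ∀ v : T.V, v ∈ T.Vbad → Set (S.L.StarPacket v)) (j : T.Label) (vQ : T.VQ),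
        ρ (fun v hv => S.L.starAut Φ v '' Ψ v hv) j vQ = Φ j vQ '' ρ Ψ j vQ)
    (hS : PilotKummerIndRelated S P ρ qK) : ¬ P.Statement ∧ ¬ BridgeHyps P := by
  classical
  -- the character of a generator: the modulus of the chosen realising homeomorphism (junk `0` off the generators)
  let c : S.L.PacketAut → ℝ := fun Φ =>
    if h : Φ ∈ S.L.Ind1Family ∪ S.L.Ind2Family then
      (Λ (Setting.labelSucc i) vQ).normalizedLogVolume (d (Setting.labelSucc i) vQ)
        (((Classical.choose (hInd Φ h) : W (Setting.labelSucc i) vQ ≃ₜ+ W (Setting.labelSucc i) vQ) :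
            W (Setting.labelSucc i) vQ → W (Setting.labelSucc i) vQ) ''
          (Λ (Setting.labelSucc i) vQ : Set (W (Setting.labelSucc i) vQ)))
    else 0
  have hc : ∀ Φ (h : Φ ∈ S.L.Ind1Family ∪ S.L.Ind2Family),
      c Φ = (Λ (Setting.labelSucc i) vQ).normalizedLogVolume (d (Setting.labelSucc i) vQ)
        (((Classical.choose (hInd Φ h) : W (Setting.labelSucc i) vQ ≃ₜ+ W (Setting.labelSucc i) vQ) :
            W (Setting.labelSucc i) vQ → W (Setting.labelSucc i) vQ) ''
          (Λ (Setting.labelSucc i) vQ : Set (W (Setting.labelSucc i) vQ))) := fun Φ h => dif_pos h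
  have hchar := fun Φ (h : Φ ∈ S.L.Ind1Family ∪ S.L.Ind2Family) =>
    volumeCharacter_of_realMeasure P Λ d e hlogvol hAdm (Classical.choose_spec (hInd Φ h))
  exact not_statement_of_pilotKummerIndRelated_of_ne_of_character hKumB hρ c (fun Φ h A => (hchar Φ h).1 A)
    (fun Φ h A hA => by rw [hc Φ h]; exact (hchar Φ h).2 A hA) (logvolMonoAt_of_realMeasure P Λ d e hlogvol hAdm)
    hΘ hΘ3 hne hS

/-- **DIRECTION-FREE EXHAUSTIVENESS: at a real-measure reading of one packet with volume MISMATCH, `¬(S ∧ Statement)` — whatever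
(Ind1)/(Ind2) are.** Packaging of `not_statement_of_pilotKummerIndRelated_of_realMeasure_of_ne`. [claim: Mochizuki2012, status: disputed] -/
theorem not_pilotKummerIndRelated_and_statement_of_realMeasure_of_ne {i : Fin T.lstar} {vQ : T.VQ}
    (hlogvol : ∀ A : Set (S.L.Packet (Setting.labelSucc i) vQ),
      (S.D P.n).logvol (Setting.labelSucc i) vQ A =
        (Λ (Setting.labelSucc i) vQ).normalizedLogVolume (d (Setting.labelSucc i) vQ) (e (Setting.labelSucc i) vQ '' A))
    (hAdm : ∀ A : Set (S.L.Packet (Setting.labelSucc i) vQ),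
      (S.D P.n).Adm (Setting.labelSucc i) vQ A ↔
        0 < (Λ (Setting.labelSucc i) vQ).haar (e (Setting.labelSucc i) vQ '' A) ∧
          (Λ (Setting.labelSucc i) vQ).haar (e (Setting.labelSucc i) vQ '' A) < ∞)
    (hInd : ∀ Φ ∈ S.L.Ind1Family ∪ S.L.Ind2Family,
      ∃ ψ : W (Setting.labelSucc i) vQ ≃ₜ+ W (Setting.labelSucc i) vQ,
        ∀ x, e (Setting.labelSucc i) vQ (Φ (Setting.labelSucc i) vQ x) = ψ (e (Setting.labelSucc i) vQ x))
    (hΘ : ∀ m : ℤ, (S.D P.n).Adm (Setting.labelSucc i) vQ (ρ ((S.col P.n).frobΨ m) (Setting.labelSucc i) vQ))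
    (hΘ3 : ∃ m : ℤ, ρ ((S.col P.n).frobΨ m) (Setting.labelSucc i) vQ ⊆ P.thetaRegion3 (Setting.labelSucc i) vQ)
    (hne : ∀ m : ℤ, (S.D P.n).logvol (Setting.labelSucc i) vQ (ρ ((S.col P.n).frobΨ m) (Setting.labelSucc i) vQ) ≠
      (S.D P.n).logvol (Setting.labelSucc i) vQ (ρ qK (Setting.labelSucc i) vQ))
    (hKumB : (S.col P.n).KummerB (S.D P.n))
    (hρ : ∀ Φ ∈ Subgroup.closure (S.L.Ind1Family ∪ S.L.Ind2Family),
      ∀ (Ψ : ∀ v : T.V, v ∈ T.Vbad → Set (S.L.StarPacket v)) (j : T.Label) (vQ : T.VQ),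
        ρ (fun v hv => S.L.starAut Φ v '' Ψ v hv) j vQ = Φ j vQ '' ρ Ψ j vQ) :
    ¬ (PilotKummerIndRelated S P ρ qK ∧ P.Statement) := fun h =>
  (not_statement_of_pilotKummerIndRelated_of_realMeasure_of_ne P ρ qK Λ d e hlogvol hAdm hInd hΘ hΘ3 hne hKumB hρ h.1).1 h.2

/-- Under the typed Θ-pin the `Θ3` side condition is automatic (p434968 `exists_subset_thetaRegion3_of_thetaPinned`) and (hρ) is its first
clause: **Θ-pin ∧ KummerB ∧ real-measure reading at one mismatching packet ⟹ ¬(S ∧ Statement)**. [claim: Mochizuki2012, status: disputed] -/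
theorem not_pilotKummerIndRelated_and_statement_of_realMeasure_of_ne_of_thetaPinned {i : Fin T.lstar} {vQ : T.VQ}
    (hlogvol : ∀ A : Set (S.L.Packet (Setting.labelSucc i) vQ),
      (S.D P.n).logvol (Setting.labelSucc i) vQ A =
        (Λ (Setting.labelSucc i) vQ).normalizedLogVolume (d (Setting.labelSucc i) vQ) (e (Setting.labelSucc i) vQ '' A))
    (hAdm : ∀ A : Set (S.L.Packet (Setting.labelSucc i) vQ),
      (S.D P.n).Adm (Setting.labelSucc i) vQ A ↔
        0 < (Λ (Setting.labelSucc i) vQ).haar (e (Setting.labelSucc i) vQ '' A) ∧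
          (Λ (Setting.labelSucc i) vQ).haar (e (Setting.labelSucc i) vQ '' A) < ∞)
    (hInd : ∀ Φ ∈ S.L.Ind1Family ∪ S.L.Ind2Family,
      ∃ ψ : W (Setting.labelSucc i) vQ ≃ₜ+ W (Setting.labelSucc i) vQ,
        ∀ x, e (Setting.labelSucc i) vQ (Φ (Setting.labelSucc i) vQ x) = ψ (e (Setting.labelSucc i) vQ x))
    (hΘadm : ThetaRegionsAdm P)
    (hne : ∀ m : ℤ, (S.D P.n).logvol (Setting.labelSucc i) vQ (ρ ((S.col P.n).frobΨ m) (Setting.labelSucc i) vQ) ≠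
      (S.D P.n).logvol (Setting.labelSucc i) vQ (ρ qK (Setting.labelSucc i) vQ))
    (hKumB : (S.col P.n).KummerB (S.D P.n)) (hΘpin : ThetaPinned S P ρ) :
    ¬ (PilotKummerIndRelated S P ρ qK ∧ P.Statement) :=
  not_pilotKummerIndRelated_and_statement_of_realMeasure_of_ne P ρ qK Λ d e hlogvol hAdm hInd
    (fun m => by rw [← hΘpin.2 m _ vQ]; exact hΘadm m _ vQ)
    (exists_subset_thetaRegion3_of_thetaPinned hΘpin _ vQ) hne hKumB hΘpin.1

/-- **The object-honest direction (Θ strictly BELOW q — Mochizuki-normalised exponents `j² > 1`):** p433142's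
`not_pilotKummerIndRelated_and_statement_of_realMeasure` recovered from the mismatch form, without its hypotheses `hq` (q-region admissible),
`hΘm` (some admissible column Θ-region) and the global `LogvolMono P` — traded for the `Θ3` side condition. [claim: Mochizuki2012, status: disputed] -/
theorem not_pilotKummerIndRelated_and_statement_of_realMeasure_of_lt {i : Fin T.lstar} {vQ : T.VQ}
    (hlogvol : ∀ A : Set (S.L.Packet (Setting.labelSucc i) vQ),
      (S.D P.n).logvol (Setting.labelSucc i) vQ A =
        (Λ (Setting.labelSucc i) vQ).normalizedLogVolume (d (Setting.labelSucc i) vQ) (e (Setting.labelSucc i) vQ '' A))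
    (hAdm : ∀ A : Set (S.L.Packet (Setting.labelSucc i) vQ),
      (S.D P.n).Adm (Setting.labelSucc i) vQ A ↔
        0 < (Λ (Setting.labelSucc i) vQ).haar (e (Setting.labelSucc i) vQ '' A) ∧
          (Λ (Setting.labelSucc i) vQ).haar (e (Setting.labelSucc i) vQ '' A) < ∞)
    (hInd : ∀ Φ ∈ S.L.Ind1Family ∪ S.L.Ind2Family,
      ∃ ψ : W (Setting.labelSucc i) vQ ≃ₜ+ W (Setting.labelSucc i) vQ,
        ∀ x, e (Setting.labelSucc i) vQ (Φ (Setting.labelSucc i) vQ x) = ψ (e (Setting.labelSucc i) vQ x))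
    (hΘ : ∀ m : ℤ, (S.D P.n).Adm (Setting.labelSucc i) vQ (ρ ((S.col P.n).frobΨ m) (Setting.labelSucc i) vQ))
    (hΘ3 : ∃ m : ℤ, ρ ((S.col P.n).frobΨ m) (Setting.labelSucc i) vQ ⊆ P.thetaRegion3 (Setting.labelSucc i) vQ)
    (hlt : ∀ m : ℤ, (S.D P.n).logvol (Setting.labelSucc i) vQ (ρ ((S.col P.n).frobΨ m) (Setting.labelSucc i) vQ) <
      (S.D P.n).logvol (Setting.labelSucc i) vQ (ρ qK (Setting.labelSucc i) vQ))
    (hKumB : (S.col P.n).KummerB (S.D P.n))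
    (hρ : ∀ Φ ∈ Subgroup.closure (S.L.Ind1Family ∪ S.L.Ind2Family),
      ∀ (Ψ : ∀ v : T.V, v ∈ T.Vbad → Set (S.L.StarPacket v)) (j : T.Label) (vQ : T.VQ),
        ρ (fun v hv => S.L.starAut Φ v '' Ψ v hv) j vQ = Φ j vQ '' ρ Ψ j vQ) :
    ¬ (PilotKummerIndRelated S P ρ qK ∧ P.Statement) :=
  not_pilotKummerIndRelated_and_statement_of_realMeasure_of_ne P ρ qK Λ d e hlogvol hAdm hInd hΘ hΘ3 (fun m => (hlt m).ne) hKumB hρ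

/-- **The Joshi-normalised direction (Θ strictly ABOVE q — [J-III] (9.9.4)'s exponents `j²/ℓ*² < 1` at the labels `j < ℓ*`, q pinned at
the last label; cf. p434968 `honestJoshiSetting_logvol_ne` on toy carriers):** at such a packet, too, `¬(S ∧ Statement)` for every
realisation of (Ind1)/(Ind2) by additive homeomorphisms. New at the real-measure level. [claim: Joshi2024ATS3, status: disputed] -/
theorem not_pilotKummerIndRelated_and_statement_of_realMeasure_of_gt {i : Fin T.lstar} {vQ : T.VQ}
    (hlogvol : ∀ A : Set (S.L.Packet (Setting.labelSucc i) vQ),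
      (S.D P.n).logvol (Setting.labelSucc i) vQ A =
        (Λ (Setting.labelSucc i) vQ).normalizedLogVolume (d (Setting.labelSucc i) vQ) (e (Setting.labelSucc i) vQ '' A))
    (hAdm : ∀ A : Set (S.L.Packet (Setting.labelSucc i) vQ),
      (S.D P.n).Adm (Setting.labelSucc i) vQ A ↔
        0 < (Λ (Setting.labelSucc i) vQ).haar (e (Setting.labelSucc i) vQ '' A) ∧
          (Λ (Setting.labelSucc i) vQ).haar (e (Setting.labelSucc i) vQ '' A) < ∞)
    (hInd : ∀ Φ ∈ S.L.Ind1Family ∪ S.L.Ind2Family,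
      ∃ ψ : W (Setting.labelSucc i) vQ ≃ₜ+ W (Setting.labelSucc i) vQ,
        ∀ x, e (Setting.labelSucc i) vQ (Φ (Setting.labelSucc i) vQ x) = ψ (e (Setting.labelSucc i) vQ x))
    (hΘ : ∀ m : ℤ, (S.D P.n).Adm (Setting.labelSucc i) vQ (ρ ((S.col P.n).frobΨ m) (Setting.labelSucc i) vQ))
    (hΘ3 : ∃ m : ℤ, ρ ((S.col P.n).frobΨ m) (Setting.labelSucc i) vQ ⊆ P.thetaRegion3 (Setting.labelSucc i) vQ)
    (hgt : ∀ m : ℤ, (S.D P.n).logvol (Setting.labelSucc i) vQ (ρ qK (Setting.labelSucc i) vQ) <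
      (S.D P.n).logvol (Setting.labelSucc i) vQ (ρ ((S.col P.n).frobΨ m) (Setting.labelSucc i) vQ))
    (hKumB : (S.col P.n).KummerB (S.D P.n))
    (hρ : ∀ Φ ∈ Subgroup.closure (S.L.Ind1Family ∪ S.L.Ind2Family),
      ∀ (Ψ : ∀ v : T.V, v ∈ T.Vbad → Set (S.L.StarPacket v)) (j : T.Label) (vQ : T.VQ),
        ρ (fun v hv => S.L.starAut Φ v '' Ψ v hv) j vQ = Φ j vQ '' ρ Ψ j vQ) :
    ¬ (PilotKummerIndRelated S P ρ qK ∧ P.Statement) :=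
  not_pilotKummerIndRelated_and_statement_of_realMeasure_of_ne P ρ qK Λ d e hlogvol hAdm hInd hΘ hΘ3 (fun m => (hgt m).ne') hKumB hρ

end Summit.ABC.IUTFork.Joshi

end
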